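import Mathlib
import Summits.Ventures.PercRepro2.HCov

/-!
# A quantitative van den Berg–Häggström–Kahn inequality for two marks under `a₁ ↮ a₂`
(blind cell PercRepro2, night-1 g29; proofs/NIGHT1-G29.md §5.2)

Under `Q = {a₁ ↮ a₂}` write `L_x = {x ∈ C(a₁)}`, `H_x = {x ∈ C(a₂)}`, `N_x = {x ∉ C(a₁) ∪ C(a₂)}` and, for
two marks `b, o`, the `Q`-masses `Z = P(Q)`, `ℓ = P(Q, L_b)`, `h = P(Q, H_b)`, `ν = P(Q, N_b)`,
`ℓ_o = P(Q, L_o)`, `h_o = P(Q, H_o)`, `LL = P(Q, L_b, L_o)`, `LH = P(Q, L_b, H_o)`, `HL`, `HH`, `NL`, `NH`.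

* `cond_cross_avoid` **(N)**: `LH · ν ≤ NH · ℓ` — in words `P(o ∈ C₂ ∣ b ∈ C₁) ≤ P(o ∈ C₂ ∣ b ∉ C₁ ∪ C₂)`:
  BHK06 Thm 1.4 under the avoidance `C(a₂) ∩ {a₁, b} = ∅` (`bhk_cross_cluster_avoid`), read through
  `Q ∩ H_bᶜ = (Q ∩ L_b) ⊔ (Q ∩ N_b)`;
* `crossWeighted_nonneg` **(FM-b)**: the cleared form of
  `(1 + ⟨H_b⟩)·(−Cov(L_b, H_o)) + (1 + ⟨L_b⟩)·(−Cov(H_b, L_o)) ≥ ⟨H_b⟩·Cov(L_b, L_o) + ⟨L_b⟩·Cov(H_b, H_o)`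
  (covariances and means under `P(· ∣ Q)`), i.e. `Z³ · [...] =`
  `(Z + h)(ℓ h_o − Z LH) + (Z + ℓ)(h ℓ_o − Z HL) − h (Z LL − ℓ ℓ_o) − ℓ (Z HH − h h_o) ≥ 0`.
  It is strictly stronger than BHK 1.4 (`Cov(σ_b, σ_o) ≥ Cov(U_b, U_o)`) whenever `Cov(U_b, U_o) > 0`.
  PROOF: the exact identity
  `Z³[...] = 2h (ℓ HH − h LH) + (Z + 2h)(ℓ NH − ν LH) + 2ℓ (h LL − ℓ HL) + (Z + 2ℓ)(h NL − ν HL)`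
  (`ring`, after `Z = ℓ + h + ν`, `h_o = LH + HH + NH`, `ℓ_o = LL + HL + NL`) and the four brackets:
  `ℓ HH ≥ h LH` (BHK 1.3 for `C(a₂)` and 1.4 under `Q`), `ℓ NH ≥ ν LH` (= (N)), and their root mirrors.
  (conditional form: `2pq²(H_H − H_L) + pr(1+2q)(H_N − H_L) + 2p²q(L_L − L_H) + qr(1+2p)(L_N − L_H) ≥ 0`).

(FM-b) is the `t → 0` form of the residual (MEANS-a₃) (`CovForm.A3Fibre.A3Between`) when `a₃` is a leaf
at `b` of weight `t` (NIGHT1-G29.md §5); the `t = 1` form `twoMeans_nonneg` (`2p(1 − p + q)(H_N − H_L) +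
2q(1 + p − q)(L_N − L_H) ≥ 0`, cleared) is proved here too, so that (MEANS-a₃) on the whole class
«`a₃` pendant at `b`» follows by affinity in the mixing parameter (paper, §5.3). Standard axioms.
-/

namespace Summit.Ventures.PercRepro2

open UnionCluster

namespace CrossWeighted

section Sets

variable {V : Type*} {E : Type*} [DecidableEq V] (ends : E → Sym2 V)

omit [DecidableEq V] in
/-- `Q = {a₂ ↮ a₁}` as the complement of the connection event. -/
lemma avoidAll_singleton_eq (a₁ a₂ : V) :
    avoidAll ends a₂ {a₁} = (connEvent ends a₂ a₁)ᶜ := by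
  ext ω
  simp [avoidAll, connEvent]

omit [DecidableEq V] in
/-- `{a₁ ↔ a₂}ᶜ = {a₂ ↔ a₁}ᶜ`. -/
lemma compl_connEvent_comm (a₁ a₂ : V) :
    (connEvent ends a₁ a₂)ᶜ = (connEvent ends a₂ a₁)ᶜ := by
  ext ω
  simp only [Set.mem_compl_iff, mem_connEvent]
  exact ⟨fun h h' => h (conn_symm h'), fun h h' => h (conn_symm h')⟩

/-- `C(a₂)` avoids `{a₁, b}` iff `a₂ ↮ a₁` and `b ∉ C(a₂)`. -/
lemma avoidAll_pair_eq (a₁ a₂ b : V) :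
    avoidAll ends a₂ {a₁, b} = avoidAll ends a₂ {a₁} ∩ (connEvent ends a₂ b)ᶜ := by
  ext ω
  simp only [avoidAll, Set.mem_setOf_eq, Finset.mem_insert, Finset.mem_singleton, forall_eq_or_imp,
    forall_eq, Set.mem_inter_iff, Set.mem_compl_iff, mem_connEvent]

omit [DecidableEq V] in
/-- On `Q`, `b ∈ C(a₁)` excludes `b ∈ C(a₂)`. -/
lemma disjoint_L_H (a₁ a₂ b : V) :
    avoidAll ends a₂ {a₁} ∩ connEvent ends a₁ b ∩ connEvent ends a₂ b = ∅ := by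
  ext ω
  simp only [Set.mem_inter_iff, avoidAll, Set.mem_setOf_eq, Finset.mem_singleton, forall_eq,
    mem_connEvent, Set.mem_empty_iff_false, iff_false, not_and]
  rintro ⟨hQ, h1⟩ h2
  exact hQ (conn_trans h2 (conn_symm h1))

end Sets

section Main

variable {V : Type*} {E : Type*} [Fintype E] [DecidableEq E] [Fintype V] [DecidableEq V]
  {R : Type*} [Field R] [LinearOrder R] [IsStrictOrderedRing R]

/-- **(N)**, cleared: `P(Q, L_b, H_o) · P(Q, N_b) ≤ P(Q, N_b, H_o) · P(Q, L_b)`, i.e.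
`P(o ∈ C₂ ∣ b ∈ C₁) ≤ P(o ∈ C₂ ∣ b ∉ C₁ ∪ C₂)` under `a₁ ↮ a₂` — BHK06 Thm 1.4 for the clusters of `a₂`
(`{o ∈ ·}`) and `a₁` (`{b ∈ ·}`) under the avoidance `C(a₂) ∩ {a₁, b} = ∅`. -/
theorem cond_cross_avoid (p : E → R) (hp : IsProbVec p) (ends : E → Sym2 V) (o a₁ a₂ b : V) :
    prob p (avoidAll ends a₂ {a₁} ∩ connEvent ends a₁ b ∩ connEvent ends a₂ o) *
        prob p (avoidAll ends a₂ {a₁} ∩ ((connEvent ends a₁ b)ᶜ ∩ (connEvent ends a₂ b)ᶜ)) ≤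
      prob p (avoidAll ends a₂ {a₁} ∩ ((connEvent ends a₁ b)ᶜ ∩ (connEvent ends a₂ b)ᶜ) ∩
          connEvent ends a₂ o) *
        prob p (avoidAll ends a₂ {a₁} ∩ connEvent ends a₁ b) := by
  classical
  -- BHK 1.4 with `s = a₂`, `t = a₁`, `X = {a₁, b}`, `𝓤 = {o ∈ ·}` (for `a₂`), `𝓥 = {b ∈ ·}` (for `a₁`)
  have h := bhk_cross_cluster_avoid p hp ends a₂ a₁ (X := {a₁, b}) (Finset.mem_insert_self a₁ {b})
    (isUpperSet_mem_setOf o) (isUpperSet_mem_setOf b)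
  rw [← connEvent_eq_clusterInEvent ends a₂ o, ← connEvent_eq_clusterInEvent ends a₁ b,
    avoidAll_pair_eq ends a₁ a₂ b] at h
  set Q := avoidAll ends a₂ {a₁} with hQdef
  set Lb := connEvent ends a₁ b
  set Hb := connEvent ends a₂ b
  set Ho := connEvent ends a₂ o
  -- `Q ∩ Hbᶜ = (Q ∩ Lb) ⊔ (Q ∩ Lbᶜ ∩ Hbᶜ)`: the masses
  have hdisj : Q ∩ Lb ∩ Hb = ∅ := disjoint_L_H ends a₁ a₂ b
  have hLsub : Q ∩ Lb ⊆ Hbᶜ := by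
    intro ω hω hH
    have : ω ∈ Q ∩ Lb ∩ Hb := ⟨hω, hH⟩
    rw [hdisj] at this
    exact this
  -- the avoidance set in the masses of the statement
  have eA : prob p (Q ∩ Hbᶜ) = prob p (Q ∩ Lb) + prob p (Q ∩ (Lbᶜ ∩ Hbᶜ)) := by
    have := prob_inter_add_prob_inter_compl p (Q ∩ Hbᶜ) Lb
    have e1 : Q ∩ Hbᶜ ∩ Lb = Q ∩ Lb := by
      ext ω
      constructor
      · rintro ⟨⟨hQ, _⟩, hL⟩; exact ⟨hQ, hL⟩
      · intro hω; exact ⟨⟨hω.1, hLsub hω⟩, hω.2⟩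
    have e2 : Q ∩ Hbᶜ ∩ Lbᶜ = Q ∩ (Lbᶜ ∩ Hbᶜ) := by
      ext ω; simp only [Set.mem_inter_iff, Set.mem_compl_iff]; tauto
    rw [e1, e2] at this
    linarith
  have eHoLb : Ho ∩ Lb ∩ (Q ∩ Hbᶜ) = Q ∩ Lb ∩ Ho := by
    ext ω
    simp only [Set.mem_inter_iff, Set.mem_compl_iff]
    constructor
    · rintro ⟨⟨hHo, hL⟩, hQ, _⟩; exact ⟨⟨hQ, hL⟩, hHo⟩
    · rintro ⟨⟨hQ, hL⟩, hHo⟩; exact ⟨⟨hHo, hL⟩, hQ, hLsub ⟨hQ, hL⟩⟩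
  have eHo : prob p (Ho ∩ (Q ∩ Hbᶜ)) =
      prob p (Q ∩ Lb ∩ Ho) + prob p (Q ∩ (Lbᶜ ∩ Hbᶜ) ∩ Ho) := by
    have := prob_inter_add_prob_inter_compl p (Ho ∩ (Q ∩ Hbᶜ)) Lb
    have e1 : Ho ∩ (Q ∩ Hbᶜ) ∩ Lb = Q ∩ Lb ∩ Ho := by
      ext ω
      simp only [Set.mem_inter_iff, Set.mem_compl_iff]
      constructor
      · rintro ⟨⟨hHo, hQ, _⟩, hL⟩; exact ⟨⟨hQ, hL⟩, hHo⟩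
      · rintro ⟨⟨hQ, hL⟩, hHo⟩; exact ⟨⟨hHo, hQ, hLsub ⟨hQ, hL⟩⟩, hL⟩
    have e2 : Ho ∩ (Q ∩ Hbᶜ) ∩ Lbᶜ = Q ∩ (Lbᶜ ∩ Hbᶜ) ∩ Ho := by
      ext ω; simp only [Set.mem_inter_iff, Set.mem_compl_iff]; tauto
    rw [e1, e2] at this
    linarith
  have eLb : Lb ∩ (Q ∩ Hbᶜ) = Q ∩ Lb := by
    ext ω
    simp only [Set.mem_inter_iff, Set.mem_compl_iff]
    constructor
    · rintro ⟨hL, hQ, _⟩; exact ⟨hQ, hL⟩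
    · intro hω; exact ⟨hω.2, hω.1, hLsub hω⟩
  rw [eHoLb, eA, eHo, eLb] at h
  nlinarith [h]

omit [Fintype V] [DecidableEq V] in
/-- The three-way split of a `Q`-mass by the status of `b`:
`P(Q ∩ X) = P(Q ∩ L_b ∩ X) + P(Q ∩ H_b ∩ X) + P(Q ∩ N_b ∩ X)`. -/
lemma status_split (p : E → R) (ends : E → Sym2 V) (a₁ a₂ b : V) (X : Set (Config E)) :
    prob p (avoidAll ends a₂ {a₁} ∩ X) =
      prob p (avoidAll ends a₂ {a₁} ∩ connEvent ends a₁ b ∩ X) +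
        prob p (avoidAll ends a₂ {a₁} ∩ connEvent ends a₂ b ∩ X) +
        prob p (avoidAll ends a₂ {a₁} ∩ ((connEvent ends a₁ b)ᶜ ∩ (connEvent ends a₂ b)ᶜ) ∩ X) := by
  classical
  set Q := avoidAll ends a₂ {a₁}
  set Lb := connEvent ends a₁ b
  set Hb := connEvent ends a₂ b
  have hdisj : Q ∩ Lb ∩ Hb = ∅ := disjoint_L_H ends a₁ a₂ b
  have h1 := prob_inter_add_prob_inter_compl p (Q ∩ X) Lb
  have h2 := prob_inter_add_prob_inter_compl p (Q ∩ X ∩ Lbᶜ) Hb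
  have e1 : Q ∩ X ∩ Lb = Q ∩ Lb ∩ X := by
    ext ω; simp only [Set.mem_inter_iff]; tauto
  have e2 : Q ∩ X ∩ Lbᶜ ∩ Hb = Q ∩ Hb ∩ X := by
    ext ω
    simp only [Set.mem_inter_iff, Set.mem_compl_iff]
    constructor
    · rintro ⟨⟨⟨hQ, hX⟩, _⟩, hH⟩; exact ⟨⟨hQ, hH⟩, hX⟩
    · rintro ⟨⟨hQ, hH⟩, hX⟩
      refine ⟨⟨⟨hQ, hX⟩, fun hL => ?_⟩, hH⟩
      have : ω ∈ Q ∩ Lb ∩ Hb := ⟨⟨hQ, hL⟩, hH⟩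
      rw [hdisj] at this
      exact this
  have e3 : Q ∩ X ∩ Lbᶜ ∩ Hbᶜ = Q ∩ (Lbᶜ ∩ Hbᶜ) ∩ X := by
    ext ω; simp only [Set.mem_inter_iff, Set.mem_compl_iff]; tauto
  rw [e1] at h1
  rw [e2, e3] at h2
  linarith

/-- **BHK 1.4 under `Q`, cleared**: `P(Q, L_b, H_o) · P(Q) ≤ P(Q, L_b) · P(Q, H_o)`. -/
theorem cross_le (p : E → R) (hp : IsProbVec p) (ends : E → Sym2 V) (o a₁ a₂ b : V) :
    prob p (avoidAll ends a₂ {a₁} ∩ connEvent ends a₁ b ∩ connEvent ends a₂ o) *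
        prob p (avoidAll ends a₂ {a₁}) ≤
      prob p (avoidAll ends a₂ {a₁} ∩ connEvent ends a₁ b) *
        prob p (avoidAll ends a₂ {a₁} ∩ connEvent ends a₂ o) := by
  classical
  have h := bhk_cross_cluster p hp ends a₁ a₂ (isUpperSet_mem_setOf b) (isUpperSet_mem_setOf o)
  rw [← connEvent_eq_clusterInEvent ends a₁ b, ← connEvent_eq_clusterInEvent ends a₂ o,
    compl_connEvent_comm ends a₁ a₂, ← avoidAll_singleton_eq ends a₁ a₂] at h
  have e1 : connEvent ends a₁ b ∩ connEvent ends a₂ o ∩ avoidAll ends a₂ {a₁} =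
      avoidAll ends a₂ {a₁} ∩ connEvent ends a₁ b ∩ connEvent ends a₂ o := by
    ext ω; simp only [Set.mem_inter_iff]; tauto
  have e2 : connEvent ends a₁ b ∩ avoidAll ends a₂ {a₁} = avoidAll ends a₂ {a₁} ∩ connEvent ends a₁ b :=
    Set.inter_comm _ _
  have e3 : connEvent ends a₂ o ∩ avoidAll ends a₂ {a₁} = avoidAll ends a₂ {a₁} ∩ connEvent ends a₂ o :=
    Set.inter_comm _ _
  rw [e1, e2, e3] at h
  exact h

/-- **BHK 1.3 under `Q` for the cluster of `a₂`, cleared**: `P(Q, H_b) · P(Q, H_o) ≤ P(Q, H_b, H_o) · P(Q)`. -/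
theorem same_H_le (p : E → R) (hp : IsProbVec p) (ends : E → Sym2 V) (o a₁ a₂ b : V) :
    prob p (avoidAll ends a₂ {a₁} ∩ connEvent ends a₂ b) *
        prob p (avoidAll ends a₂ {a₁} ∩ connEvent ends a₂ o) ≤
      prob p (avoidAll ends a₂ {a₁} ∩ connEvent ends a₂ b ∩ connEvent ends a₂ o) *
        prob p (avoidAll ends a₂ {a₁}) := by
  classical
  have h := bhk_same_cluster_events p hp ends a₂ a₁ (isUpperSet_mem_setOf b) (isUpperSet_mem_setOf o)
  rw [← connEvent_eq_clusterInEvent ends a₂ b, ← connEvent_eq_clusterInEvent ends a₂ o,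
    ← avoidAll_singleton_eq ends a₁ a₂] at h
  have e1 : connEvent ends a₂ b ∩ avoidAll ends a₂ {a₁} = avoidAll ends a₂ {a₁} ∩ connEvent ends a₂ b :=
    Set.inter_comm _ _
  have e2 : connEvent ends a₂ o ∩ avoidAll ends a₂ {a₁} = avoidAll ends a₂ {a₁} ∩ connEvent ends a₂ o :=
    Set.inter_comm _ _
  have e3 : connEvent ends a₂ b ∩ connEvent ends a₂ o ∩ avoidAll ends a₂ {a₁} =
      avoidAll ends a₂ {a₁} ∩ connEvent ends a₂ b ∩ connEvent ends a₂ o := by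
    ext ω; simp only [Set.mem_inter_iff]; tauto
  rw [e1, e2, e3] at h
  exact h

/-- **BHK 1.3 under `Q` for the cluster of `a₁`, cleared**: `P(Q, L_b) · P(Q, L_o) ≤ P(Q, L_b, L_o) · P(Q)`. -/
theorem same_L_le (p : E → R) (hp : IsProbVec p) (ends : E → Sym2 V) (o a₁ a₂ b : V) :
    prob p (avoidAll ends a₂ {a₁} ∩ connEvent ends a₁ b) *
        prob p (avoidAll ends a₂ {a₁} ∩ connEvent ends a₁ o) ≤
      prob p (avoidAll ends a₂ {a₁} ∩ connEvent ends a₁ b ∩ connEvent ends a₁ o) *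
        prob p (avoidAll ends a₂ {a₁}) := by
  classical
  have h := bhk_same_cluster_events p hp ends a₁ a₂ (isUpperSet_mem_setOf b) (isUpperSet_mem_setOf o)
  rw [← connEvent_eq_clusterInEvent ends a₁ b, ← connEvent_eq_clusterInEvent ends a₁ o,
    compl_connEvent_comm ends a₁ a₂, ← avoidAll_singleton_eq ends a₁ a₂] at h
  have e1 : connEvent ends a₁ b ∩ avoidAll ends a₂ {a₁} = avoidAll ends a₂ {a₁} ∩ connEvent ends a₁ b :=
    Set.inter_comm _ _
  have e2 : connEvent ends a₁ o ∩ avoidAll ends a₂ {a₁} = avoidAll ends a₂ {a₁} ∩ connEvent ends a₁ o :=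
    Set.inter_comm _ _
  have e3 : connEvent ends a₁ b ∩ connEvent ends a₁ o ∩ avoidAll ends a₂ {a₁} =
      avoidAll ends a₂ {a₁} ∩ connEvent ends a₁ b ∩ connEvent ends a₁ o := by
    ext ω; simp only [Set.mem_inter_iff]; tauto
  rw [e1, e2, e3] at h
  exact h

/-- **(FM-b), cleared** (proofs/NIGHT1-G29.md §5.2): with the `Q`-masses of `b` and `o`,
`(Z + h)(ℓ h_o − Z LH) + (Z + ℓ)(h ℓ_o − Z HL) − h (Z LL − ℓ ℓ_o) − ℓ (Z HH − h h_o) ≥ 0`, i.e.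
`(1 + ⟨H_b⟩)(−Cov(L_b, H_o)) + (1 + ⟨L_b⟩)(−Cov(H_b, L_o)) ≥ ⟨H_b⟩ Cov(L_b, L_o) + ⟨L_b⟩ Cov(H_b, H_o)`
under `P(· ∣ a₁ ↮ a₂)` — a quantitative BHK: strictly stronger than Thm 1.4 whenever `Cov(U_b, U_o) > 0`. -/
theorem crossWeighted_nonneg (p : E → R) (hp : IsProbVec p) (ends : E → Sym2 V) (o a₁ a₂ b : V) :
    0 ≤ (prob p (avoidAll ends a₂ {a₁}) + prob p (avoidAll ends a₂ {a₁} ∩ connEvent ends a₂ b)) *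
          (prob p (avoidAll ends a₂ {a₁} ∩ connEvent ends a₁ b) *
              prob p (avoidAll ends a₂ {a₁} ∩ connEvent ends a₂ o) -
            prob p (avoidAll ends a₂ {a₁}) *
              prob p (avoidAll ends a₂ {a₁} ∩ connEvent ends a₁ b ∩ connEvent ends a₂ o)) +
        (prob p (avoidAll ends a₂ {a₁}) + prob p (avoidAll ends a₂ {a₁} ∩ connEvent ends a₁ b)) *
          (prob p (avoidAll ends a₂ {a₁} ∩ connEvent ends a₂ b) *
              prob p (avoidAll ends a₂ {a₁} ∩ connEvent ends a₁ o) -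
            prob p (avoidAll ends a₂ {a₁}) *
              prob p (avoidAll ends a₂ {a₁} ∩ connEvent ends a₂ b ∩ connEvent ends a₁ o)) -
        prob p (avoidAll ends a₂ {a₁} ∩ connEvent ends a₂ b) *
          (prob p (avoidAll ends a₂ {a₁}) *
              prob p (avoidAll ends a₂ {a₁} ∩ connEvent ends a₁ b ∩ connEvent ends a₁ o) -
            prob p (avoidAll ends a₂ {a₁} ∩ connEvent ends a₁ b) *
              prob p (avoidAll ends a₂ {a₁} ∩ connEvent ends a₁ o)) -
        prob p (avoidAll ends a₂ {a₁} ∩ connEvent ends a₁ b) *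
          (prob p (avoidAll ends a₂ {a₁}) *
              prob p (avoidAll ends a₂ {a₁} ∩ connEvent ends a₂ b ∩ connEvent ends a₂ o) -
            prob p (avoidAll ends a₂ {a₁} ∩ connEvent ends a₂ b) *
              prob p (avoidAll ends a₂ {a₁} ∩ connEvent ends a₂ o)) := by
  classical
  set Q := avoidAll ends a₂ {a₁} with hQ
  set Lb := connEvent ends a₁ b
  set Hb := connEvent ends a₂ b
  set Lo := connEvent ends a₁ o
  set Ho := connEvent ends a₂ o
  set Nb := Lbᶜ ∩ Hbᶜ
  set Z := prob p Q
  set l := prob p (Q ∩ Lb)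
  set h := prob p (Q ∩ Hb)
  set nu := prob p (Q ∩ Nb)
  set lo := prob p (Q ∩ Lo)
  set ho := prob p (Q ∩ Ho)
  set LL := prob p (Q ∩ Lb ∩ Lo)
  set LH := prob p (Q ∩ Lb ∩ Ho)
  set HL := prob p (Q ∩ Hb ∩ Lo)
  set HH := prob p (Q ∩ Hb ∩ Ho)
  set NL := prob p (Q ∩ Nb ∩ Lo)
  set NH := prob p (Q ∩ Nb ∩ Ho)
  -- additivity
  have hZ : Z = l + h + nu := by
    have := status_split p ends a₁ a₂ b Set.univ
    simp only [Set.inter_univ] at this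
    exact this
  have hho : ho = LH + HH + NH := status_split p ends a₁ a₂ b Ho
  have hlo : lo = LL + HL + NL := status_split p ends a₁ a₂ b Lo
  have hZ0 : 0 ≤ Z := prob_nonneg hp _
  have hl0 : 0 ≤ l := prob_nonneg hp _
  have hh0 : 0 ≤ h := prob_nonneg hp _
  have hnu0 : 0 ≤ nu := prob_nonneg hp _
  -- the four BHK brackets, cleared by `Z`
  have b1 := cross_le p hp ends o a₁ a₂ b      -- LH * Z ≤ l * ho
  have b1' := same_H_le p hp ends o a₁ a₂ b    -- h * ho ≤ HH * Z
  have b2 := cond_cross_avoid p hp ends o a₁ a₂ b   -- LH * nu ≤ NH * l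
  -- mirrors (swap the roots): `P(Q, H_b, L_o) Z ≤ h ℓ_o`, `ℓ ℓ_o ≤ LL Z`, `HL ν ≤ NL h`
  have b3 : HL * Z ≤ h * lo := by
    have h' := cross_le p hp ends o a₂ a₁ b
    -- `avoidAll ends a₁ {a₂} = Q` up to `conn_symm`
    have eQ : avoidAll ends a₁ {a₂} = Q := by
      rw [hQ, avoidAll_singleton_eq ends a₂ a₁, avoidAll_singleton_eq ends a₁ a₂,
        compl_connEvent_comm ends a₂ a₁]
    rw [eQ] at h'
    exact h'
  have b3' : l * lo ≤ LL * Z := same_L_le p hp ends o a₁ a₂ b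
  have b4 : HL * nu ≤ NL * h := by
    have h' := cond_cross_avoid p hp ends o a₂ a₁ b
    have eQ : avoidAll ends a₁ {a₂} = Q := by
      rw [hQ, avoidAll_singleton_eq ends a₂ a₁, avoidAll_singleton_eq ends a₁ a₂,
        compl_connEvent_comm ends a₂ a₁]
    have eN : (connEvent ends a₂ b)ᶜ ∩ (connEvent ends a₁ b)ᶜ = Nb := Set.inter_comm _ _
    rw [eQ, eN] at h'
    exact h'
  -- the brackets themselves
  rcases eq_or_lt_of_le hZ0 with hZz | hZpos
  · -- `P(Q) = 0`: every mass vanishes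
    have hsub : ∀ A : Set (Config E), A ⊆ Q → prob p A = 0 := fun A hA =>
      le_antisymm (hZz ▸ prob_mono hp hA) (prob_nonneg hp _)
    have e1 : l = 0 := hsub _ Set.inter_subset_left
    have e2 : h = 0 := hsub _ Set.inter_subset_left
    have e3 : LH = 0 := hsub _ (fun ω hω => hω.1.1)
    have e4 : HL = 0 := hsub _ (fun ω hω => hω.1.1)
    have e5 : LL = 0 := hsub _ (fun ω hω => hω.1.1)
    have e6 : HH = 0 := hsub _ (fun ω hω => hω.1.1)
    rw [← hZz, e1, e2, e3, e4, e5, e6]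
    simp
  · have B1 : h * LH ≤ l * HH := by
      have : Z * (h * LH) ≤ Z * (l * HH) := by nlinarith [mul_le_mul_of_nonneg_left b1 hh0, mul_le_mul_of_nonneg_left b1' hl0]
      exact le_of_mul_le_mul_left this hZpos
    have B3 : l * HL ≤ h * LL := by
      have : Z * (l * HL) ≤ Z * (h * LL) := by nlinarith [mul_le_mul_of_nonneg_left b3 hl0, mul_le_mul_of_nonneg_left b3' hh0]
      exact le_of_mul_le_mul_left this hZpos
    have key : (Z + h) * (l * ho - Z * LH) + (Z + l) * (h * lo - Z * HL) - h * (Z * LL - l * lo) -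
        l * (Z * HH - h * ho) =
        2 * h * (l * HH - h * LH) + (Z + 2 * h) * (l * NH - nu * LH) + 2 * l * (h * LL - l * HL) +
          (Z + 2 * l) * (h * NL - nu * HL) := by
      rw [hZ, hho, hlo]; ring
    rw [key]
    have t1 : 0 ≤ 2 * h * (l * HH - h * LH) := mul_nonneg (by positivity) (by linarith)
    have t2 : 0 ≤ (Z + 2 * h) * (l * NH - nu * LH) := mul_nonneg (by positivity) (by linarith)
    have t3 : 0 ≤ 2 * l * (h * LL - l * HL) := mul_nonneg (by positivity) (by linarith)
    have t4 : 0 ≤ (Z + 2 * l) * (h * NL - nu * HL) := mul_nonneg (by positivity) (by linarith)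
    linarith

/-- **The `t = 1` form (M1), cleared** (NIGHT1-G29.md §5.3): `2(Z − ℓ + h)(ℓ NH − ν LH) + 2(Z + ℓ − h)(h NL − ν HL) ≥ 0`
— `Z² ν · [Cov(σ_b, σ_o) − Cov(σ_b, σ_b (U_o − P(U_o ∣ b ∉ U)))]`, both brackets by (N) and its mirror. -/
theorem twoMeans_nonneg (p : E → R) (hp : IsProbVec p) (ends : E → Sym2 V) (o a₁ a₂ b : V) :
    0 ≤ 2 * (prob p (avoidAll ends a₂ {a₁}) - prob p (avoidAll ends a₂ {a₁} ∩ connEvent ends a₁ b) +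
            prob p (avoidAll ends a₂ {a₁} ∩ connEvent ends a₂ b)) *
          (prob p (avoidAll ends a₂ {a₁} ∩ connEvent ends a₁ b) *
              prob p (avoidAll ends a₂ {a₁} ∩ ((connEvent ends a₁ b)ᶜ ∩ (connEvent ends a₂ b)ᶜ) ∩
                connEvent ends a₂ o) -
            prob p (avoidAll ends a₂ {a₁} ∩ ((connEvent ends a₁ b)ᶜ ∩ (connEvent ends a₂ b)ᶜ)) *
              prob p (avoidAll ends a₂ {a₁} ∩ connEvent ends a₁ b ∩ connEvent ends a₂ o)) +
        2 * (prob p (avoidAll ends a₂ {a₁}) + prob p (avoidAll ends a₂ {a₁} ∩ connEvent ends a₁ b) -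
            prob p (avoidAll ends a₂ {a₁} ∩ connEvent ends a₂ b)) *
          (prob p (avoidAll ends a₂ {a₁} ∩ connEvent ends a₂ b) *
              prob p (avoidAll ends a₂ {a₁} ∩ ((connEvent ends a₁ b)ᶜ ∩ (connEvent ends a₂ b)ᶜ) ∩
                connEvent ends a₁ o) -
            prob p (avoidAll ends a₂ {a₁} ∩ ((connEvent ends a₁ b)ᶜ ∩ (connEvent ends a₂ b)ᶜ)) *
              prob p (avoidAll ends a₂ {a₁} ∩ connEvent ends a₂ b ∩ connEvent ends a₁ o)) := by
  classical
  set Q := avoidAll ends a₂ {a₁} with hQ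
  set Lb := connEvent ends a₁ b
  set Hb := connEvent ends a₂ b
  set Nb := Lbᶜ ∩ Hbᶜ
  have b2 := cond_cross_avoid p hp ends o a₁ a₂ b
  have b4 : prob p (Q ∩ Hb ∩ connEvent ends a₁ o) * prob p (Q ∩ Nb) ≤
      prob p (Q ∩ Nb ∩ connEvent ends a₁ o) * prob p (Q ∩ Hb) := by
    have h' := cond_cross_avoid p hp ends o a₂ a₁ b
    have eQ : avoidAll ends a₁ {a₂} = Q := by
      rw [hQ, avoidAll_singleton_eq ends a₂ a₁, avoidAll_singleton_eq ends a₁ a₂,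
        compl_connEvent_comm ends a₂ a₁]
    have eN : (connEvent ends a₂ b)ᶜ ∩ (connEvent ends a₁ b)ᶜ = Nb := Set.inter_comm _ _
    rw [eQ, eN] at h'
    exact h'
  have hZ : prob p Q = prob p (Q ∩ Lb) + prob p (Q ∩ Hb) + prob p (Q ∩ Nb) := by
    have := status_split p ends a₁ a₂ b Set.univ
    simp only [Set.inter_univ] at this
    exact this
  have hl0 : 0 ≤ prob p (Q ∩ Lb) := prob_nonneg hp _
  have hh0 : 0 ≤ prob p (Q ∩ Hb) := prob_nonneg hp _
  have hnu0 : 0 ≤ prob p (Q ∩ Nb) := prob_nonneg hp _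
  have c1 : 0 ≤ prob p Q - prob p (Q ∩ Lb) + prob p (Q ∩ Hb) := by linarith
  have c2 : 0 ≤ prob p Q + prob p (Q ∩ Lb) - prob p (Q ∩ Hb) := by linarith
  have t1 := mul_nonneg (mul_nonneg (by norm_num : (0 : R) ≤ 2) c1) (sub_nonneg.2 b2)
  have t2 := mul_nonneg (mul_nonneg (by norm_num : (0 : R) ≤ 2) c2) (sub_nonneg.2 b4)
  linarith

end Main

end CrossWeighted

end Summit.Ventures.PercRepro2
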